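import Literature.MathematicalPhysics.QuantumFieldTheory.Balaban1983to89.B15Prop1DatumCoordinatesTower
import Literature.MathematicalPhysics.QuantumFieldTheory.Balaban1983to89.Node00.MultiScaleFibreChartB

/-!
# `Balaban1983to89.B15Prop1DatumCoordinatesTowerB` — [Balaban1985Variational] Sect. C (44)–(48) p. 285, (82)–(83) p. 290; [Balaban1987RG1] (0.4) p. 253; [Balaban1988Convergent] (2.10)–(2.12) p. 256;
# [Balaban1984PropagatorsII] (= [II]) (2.3) p. 224: THE HOLOMORPHIC DATUM COORDINATES `κ` ALONG THE TOWERS OF THE CONSTRAINED BONDS **OF A BOND-LEVEL DATUM `𝐁ᵇ`** (guard ∕ analyticity ∕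
# reality ∕ zero-on-the-fibre ∕ injectivity) — the print-datum edition of the lane's `B15Prop1DatumCoordinatesTower` §1 (from `eventually_guardOn_constr` on), §2, §3, keyed on the lane's
# `Node00/MultiScaleFibreChartB` (`constrCardB ∕ constrEnumB`) and F0a `AgreeOnB`

statement-level skeleton of published theorems with citation tags; proofs where landed; nothing here is a claim about
the Yang–Mills mass gap

Cell `pub-ymgap` (HUMAN RULINGS D-0062 ∕ D-0149), lane `pub-ymgap-dag-n12-c` g35 (R134 seat (a), N12 = [B15], s1, lane owner); `--kind proof --supports` K1⁹ `stmt-QuantumFields-27364`;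
count-neutral.  THEOREMS ONLY (0 `def`, 0 `instance`, 0 `sorry`).  (E1) variant (iii-b), class (γ) of the lane's census-by-declaration v2 (bus [DAGN12C-G35], 2026-08-30): NINE declarations of the
parent with datum-bearing statements are used by N12's junction of record v14ᴸ.  PURE-INDEX convention: the parent reads `𝐁` only through n07-w2's enumeration `constrCard ∕ constrEnum 𝐁 k` and
`AgreeOn 𝐁`; GENERATOR twin (namespace `…B`, SAME theorem names, `DetSet ↦ BDetSet`, `constrCard ∕ constrEnum ↦ …B`, `AgreeOn ↦ AgreeOnB`, `bondsOf (𝐁 j) ↦ 𝔅 j`, proofs VERBATIM); the parent's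
datum-free tower lemmas (`star_coe_mul_iterMh_coeField_of_guardOn`, `polydiscOn_constr_of_guardOn`, `eventually_polydiscOn_one_constr`) and dag-n12-w?'s `B15Prop1DatumCoordinates` ∕
`B15AveragingHolomorphic*` calculus REUSED by name.

HONESTY GUARD (director-ym №338 (5)).  PURELY ADDITIVE: the parent stays landed and true on its own text; nothing in it is edited; no displayed premise of any consumer is deleted or weakened.
Kernel calculus; nothing of [15] asserted; count-neutral; N12 NOT discharged; K0⁷ ∕ K1⁹ NOT closed; one finite 𝕋⁴ programme at fixed ε — nothing continuum ∕ ℝ⁴ ∕ OS; the Yang–Mills mass gap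
(Clay) is NOT proved by any of this.

WHAT IS HERE (all over `𝔅 : BDetSet P`).  §1 ★ `eventually_guardOn_constr`; §2 `eventually_norm_rel_sub_one_lt_of_guardOn` · ★ `datumCoord_coeField_eq_zero_of_agreeOn_of_guardOn` · ★★
`eventually_analyticAt_datumCoord_of_guardOn` · `eventually_differentiableAt_datumCoord_of_guardOn` · ★★ `eventually_datumCoord_real_of_guardOn` · ★★ `eventually_datumCoord_theta_of_guardOn`;
§3 ★★ `agreeOn_of_datumCoord_eq_of_guardOn` · ★ `eventually_agreeOn_of_datumCoord_eq_of_guardOn` (conclusions `AgreeOnB 𝔅 …`).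

References: [15] = [Balaban1985Variational] Sect. C (44)–(48) p.285, (82)–(83) p.290; [I] = [Balaban1987RG1] (0.4) p.253, (0.21) p.256; [III] = [Balaban1988Convergent] (2.2) p.255, (2.10)–(2.12) p.256;
[Balaban1985Averaging] (17)–(26) pp.21–22; [II] = [Balaban1984PropagatorsII] (2.3) p.224.
-/

noncomputable section

namespace Literature.MathematicalPhysics.QuantumFieldTheory.Balaban1983to89.B15Prop1DatumCoordinatesTowerB

open Set Filter
open scoped Topology ComplexConjugate
open Literature.MathematicalPhysics.QuantumFieldTheory.Balaban1983to89.Node00 (SU coeField coeField_apply SmallBelow ConstrSetB constrCardB constrEnumB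
  coe_loopHol norm_loopM_coeField_sub_one_lt star_coe_mul_coe_SU coe_mul_star_coe_SU)
open B15AveragingHolomorphic (holMh loopMh iterMh loopMh_coeField)
open B15AveragingAnalytic (analyticAt_holMh analyticAt_logCoordC)
open B15AveragingHolomorphicLocalAnalytic (analyticAt_iterMh_apply_of_polydiscOn eventually_polydiscOn polydiscOn_of_guardOn eventually_guardOn eventually_polydiscOn_one
  iterMh_theta_apply_of_polydiscOn)
open B15AveragingHolomorphicTowerRegion (preimage_blockIter_saturated self_mem_bondsIn_towerRegion iterMh_coeField_apply_eq_of_guardOn_towerRegion)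
open B15SU2ChartHolomorphic (genE expPointC expMulC logCoordC logCoordC_apply expPointC_logCoordC logCoordC_theta)
open B15Prop1DatumCoordinates (logCoordC_one star_inv_relMatrix det_relMatrix deltaSU_le_one)
open ExpMeanLog (expMeanLogSU deltaSU lt_third_of_lt_deltaSU)
open MatrixLog (mlog mlog_one)
open BlockAveraging (Small Idx blockAvg)
open B10Eq42TorusConstraint (bondsIn mem_bondsIn_iff)
open B14.Eq22Determines (blockIter)
open T4CubeChartGnomonic (SU2)
open T4Continuum B15DeterminingSets B15DeterminingSetsB GaugeField
open B15Prop1DatumCoordinatesTower (star_coe_mul_iterMh_coeField_of_guardOn polydiscOn_constr_of_guardOn eventually_polydiscOn_one_constr)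
open scoped Matrix.Norms.L2Operator


/-! ## §1  One tower-guarded constrained bond; the tower guards at all constrained bonds are open -/

section Guard

variable {P : Params} {N : ℕ} [NeZero N]

variable (𝔅 : BDetSet P) (k : ℕ)

/-- ★ **THE TOWER GUARDS AT ALL CONSTRAINED BONDS ARE OPEN** (the twin of `B15Prop1DatumCoordinates.eventually_smallBelow`): near the matrix field of an `SU(N)` configuration guarded along
the tower of every constrained bond of `𝔅` of level `≤ k`, every `SU(N)` configuration is so guarded (finitely many bonds; `…LocalAnalytic.eventually_guardOn` at each tower region).
[cite: Balaban1987RG1, (0.4) p.253, (0.21) p.256; Balaban1988Convergent, (2.2) p.255] -/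
theorem eventually_guardOn_constr (hk : k ≤ P.m + P.K) {U₀ : GaugeField P 0 (SU N)}
    (hg : ∀ i : Fin (constrCardB 𝔅 k), ∀ j', j' < (((constrEnumB 𝔅 k).symm i).1 : ℕ) → ∀ c' : PBond P (j' + 1),
      c' ∈ bondsIn (j' + 1) (blockIter (((constrEnumB 𝔅 k).symm i).1 : ℕ) ⁻¹'
        ({((constrEnumB 𝔅 k).symm i).2.1.src, ((constrEnumB 𝔅 k).symm i).2.1.tgt} : Set (Site P ((constrEnumB 𝔅 k).symm i).1))) →
        Small expMeanLogSU (Averaging.iter (fun j => blockAvg (P := P) (j := j) expMeanLogSU) j' U₀) c') :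
    ∀ᶠ Q in 𝓝 (coeField U₀), ∀ U : GaugeField P 0 (SU N), coeField U = Q →
      ∀ i : Fin (constrCardB 𝔅 k), ∀ j', j' < (((constrEnumB 𝔅 k).symm i).1 : ℕ) → ∀ c' : PBond P (j' + 1),
        c' ∈ bondsIn (j' + 1) (blockIter (((constrEnumB 𝔅 k).symm i).1 : ℕ) ⁻¹'
          ({((constrEnumB 𝔅 k).symm i).2.1.src, ((constrEnumB 𝔅 k).symm i).2.1.tgt} : Set (Site P ((constrEnumB 𝔅 k).symm i).1))) →
          Small expMeanLogSU (Averaging.iter (fun j => blockAvg (P := P) (j := j) expMeanLogSU) j' U) c' := by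
  have key : ∀ i : Fin (constrCardB 𝔅 k), ∀ᶠ Q in 𝓝 (coeField U₀), ∀ U : GaugeField P 0 (SU N), coeField U = Q →
      ∀ j', j' < (((constrEnumB 𝔅 k).symm i).1 : ℕ) → ∀ c' : PBond P (j' + 1),
        c' ∈ bondsIn (j' + 1) (blockIter (((constrEnumB 𝔅 k).symm i).1 : ℕ) ⁻¹'
          ({((constrEnumB 𝔅 k).symm i).2.1.src, ((constrEnumB 𝔅 k).symm i).2.1.tgt} : Set (Site P ((constrEnumB 𝔅 k).symm i).1))) →
          Small expMeanLogSU (Averaging.iter (fun j => blockAvg (P := P) (j := j) expMeanLogSU) j' U) c' := fun i =>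
    have hj : (((constrEnumB 𝔅 k).symm i).1 : ℕ) ≤ P.m + P.K := (Nat.lt_succ_iff.1 ((constrEnumB 𝔅 k).symm i).1.2).trans hk
    eventually_guardOn _ hj (preimage_blockIter_saturated hj _) (hg i)
  filter_upwards [eventually_all.2 key] with Q hQ U hU i using hQ i U hU

end Guard

/-! ## §2  The logarithmic datum coordinates under the tower guards -/

section Coordinates

variable {P : Params} (𝔅 : BDetSet P) (k : ℕ) (hk : k ≤ P.m + P.K) (W : MSField P SU2)
include hk

/-- The relative holomorphic average at every constrained bond is analytic near a tower-guarded base datum on the fibre and CLOSE TO `1` there (continuity; it equals `1` on the fibre) — the twin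
of `B15Prop1DatumCoordinates.eventually_norm_rel_sub_one_lt`. [cite: Balaban1987RG1, (0.4) p.253; Balaban1988Convergent, (2.11) p.256 (bookkeeping)] -/
theorem eventually_norm_rel_sub_one_lt_of_guardOn {Q₀ : GaugeField P 0 SU2}
    (hg : ∀ i : Fin (constrCardB 𝔅 k), ∀ j', j' < (((constrEnumB 𝔅 k).symm i).1 : ℕ) → ∀ c' : PBond P (j' + 1),
      c' ∈ bondsIn (j' + 1) (blockIter (((constrEnumB 𝔅 k).symm i).1 : ℕ) ⁻¹'
        ({((constrEnumB 𝔅 k).symm i).2.1.src, ((constrEnumB 𝔅 k).symm i).2.1.tgt} : Set (Site P ((constrEnumB 𝔅 k).symm i).1))) →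
        Small expMeanLogSU (Averaging.iter (fun j => blockAvg (P := P) (j := j) expMeanLogSU) j' Q₀) c')
    (hW : AgreeOnB 𝔅 (avgFamily (fun j => blockAvg (P := P) (j := j) expMeanLogSU) Q₀) W) {r : ℝ} (hr : 0 < r) :
    ∀ᶠ Q in 𝓝 (coeField Q₀), ∀ i : Fin (constrCardB 𝔅 k),
      ‖star ((W ((constrEnumB 𝔅 k).symm i).1 ((constrEnumB 𝔅 k).symm i).2.1 : SU2) : Matrix (Fin 2) (Fin 2) ℂ) *
          iterMh ((constrEnumB 𝔅 k).symm i).1 Q ((constrEnumB 𝔅 k).symm i).2.1 - 1‖ < r := by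
  refine eventually_all.2 fun i => ?_
  set s := (constrEnumB 𝔅 k).symm i with hs
  have hjk : (s.1 : ℕ) ≤ k := Nat.lt_succ_iff.1 s.1.2
  have hj : (s.1 : ℕ) ≤ P.m + P.K := hjk.trans hk
  have hit : AnalyticAt ℂ (fun Q : PBond P 0 → Matrix (Fin 2) (Fin 2) ℂ => iterMh (s.1 : ℕ) Q s.2.1) (coeField Q₀) :=
    analyticAt_iterMh_apply_of_polydiscOn _ hj (preimage_blockIter_saturated hj _)
      (fun j' hj' c' hc' i' => lt_of_lt_of_le (polydiscOn_constr_of_guardOn hj s.2.1 (hg i) (fun _ _ => rfl) j' hj' c' hc' i') deltaSU_le_one)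
      _ (self_mem_bondsIn_towerRegion hj _)
  have hc : ContinuousAt (fun Q : PBond P 0 → Matrix (Fin 2) (Fin 2) ℂ =>
      ‖star ((W s.1 s.2.1 : SU2) : Matrix (Fin 2) (Fin 2) ℂ) * iterMh s.1 Q s.2.1 - 1‖) (coeField Q₀) :=
    (((continuousAt_const.mul hit.continuousAt)).sub continuousAt_const).norm
  have h0 : ‖star ((W s.1 s.2.1 : SU2) : Matrix (Fin 2) (Fin 2) ℂ) * iterMh s.1 (coeField Q₀) s.2.1 - 1‖ < r := by
    rw [star_coe_mul_iterMh_coeField_of_guardOn W hj s.2.1 (hg i), hW _ _ s.2.2, star_coe_mul_coe_SU, sub_self, norm_zero]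
    exact hr
  exact hc.eventually (Iio_mem_nhds h0)

variable (κ : (PBond P 0 → Matrix (Fin 2) (Fin 2) ℂ) → Fin (constrCardB 𝔅 k) → EuclideanSpace ℂ (Fin 3))
  (hκ : ∀ Q i, κ Q i = logCoordC (star ((W ((constrEnumB 𝔅 k).symm i).1 ((constrEnumB 𝔅 k).symm i).2.1 : SU2) : Matrix (Fin 2) (Fin 2) ℂ) *
    iterMh ((constrEnumB 𝔅 k).symm i).1 Q ((constrEnumB 𝔅 k).symm i).2.1))
include hκ

/-- ★ **ZERO ON THE FIBRE** (twin of `datumCoord_coeField_eq_zero_of_agreeOn`): at an `SU(2)` field `U` guarded along the towers of the constrained bonds whose averages agree with `W` on `𝔅`,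
every datum coordinate vanishes (`W⋆W = 1`, `log 1 = 0`). [cite: Balaban1988Convergent, (2.10)–(2.12) p.256; Balaban1985Variational, Sect. C (47) p.285] -/
theorem datumCoord_coeField_eq_zero_of_agreeOn_of_guardOn {U : GaugeField P 0 SU2}
    (hg : ∀ i : Fin (constrCardB 𝔅 k), ∀ j', j' < (((constrEnumB 𝔅 k).symm i).1 : ℕ) → ∀ c' : PBond P (j' + 1),
      c' ∈ bondsIn (j' + 1) (blockIter (((constrEnumB 𝔅 k).symm i).1 : ℕ) ⁻¹'
        ({((constrEnumB 𝔅 k).symm i).2.1.src, ((constrEnumB 𝔅 k).symm i).2.1.tgt} : Set (Site P ((constrEnumB 𝔅 k).symm i).1))) →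
        Small expMeanLogSU (Averaging.iter (fun j => blockAvg (P := P) (j := j) expMeanLogSU) j' U) c')
    (hU : AgreeOnB 𝔅 (avgFamily (fun j => blockAvg (P := P) (j := j) expMeanLogSU) U) W) : κ (coeField U) = 0 := by
  funext i
  have hj : ((((constrEnumB 𝔅 k).symm i).1 : ℕ)) ≤ P.m + P.K := (Nat.lt_succ_iff.1 ((constrEnumB 𝔅 k).symm i).1.2).trans hk
  rw [hκ, star_coe_mul_iterMh_coeField_of_guardOn W hj _ (hg i), hU _ _ ((constrEnumB 𝔅 k).symm i).2.2, star_coe_mul_coe_SU, logCoordC_one]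
  rfl

/-- ★★ **THE DATUM COORDINATES ARE ANALYTIC NEAR A TOWER-GUARDED BASE DATUM ON THE FIBRE** (twin of `eventually_analyticAt_datumCoord`: the iterate at each constrained bond is analytic on the
tower polydisc, which is open; the relative average stays within `1` of `1`, where `logCoordC` is analytic). [cite: Balaban1985Variational, Sect. G p.305, Prop. 9 (190) p.309; Balaban1987RG1, (0.4) p.253; Balaban1985Averaging, (21) p.21] -/
theorem eventually_analyticAt_datumCoord_of_guardOn {Q₀ : GaugeField P 0 SU2}
    (hg : ∀ i : Fin (constrCardB 𝔅 k), ∀ j', j' < (((constrEnumB 𝔅 k).symm i).1 : ℕ) → ∀ c' : PBond P (j' + 1),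
      c' ∈ bondsIn (j' + 1) (blockIter (((constrEnumB 𝔅 k).symm i).1 : ℕ) ⁻¹'
        ({((constrEnumB 𝔅 k).symm i).2.1.src, ((constrEnumB 𝔅 k).symm i).2.1.tgt} : Set (Site P ((constrEnumB 𝔅 k).symm i).1))) →
        Small expMeanLogSU (Averaging.iter (fun j => blockAvg (P := P) (j := j) expMeanLogSU) j' Q₀) c')
    (hW : AgreeOnB 𝔅 (avgFamily (fun j => blockAvg (P := P) (j := j) expMeanLogSU) Q₀) W) :
    ∀ᶠ Q in 𝓝 (coeField Q₀), AnalyticAt ℂ κ Q := by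
  have hfun : κ = fun Q i => logCoordC (star ((W ((constrEnumB 𝔅 k).symm i).1 ((constrEnumB 𝔅 k).symm i).2.1 : SU2) : Matrix (Fin 2) (Fin 2) ℂ) *
      iterMh ((constrEnumB 𝔅 k).symm i).1 Q ((constrEnumB 𝔅 k).symm i).2.1) := funext fun Q => funext (hκ Q)
  have hpolyAll : ∀ᶠ Q in 𝓝 (coeField Q₀), ∀ i : Fin (constrCardB 𝔅 k),
      ∀ j', j' < (((constrEnumB 𝔅 k).symm i).1 : ℕ) → ∀ c' : PBond P (j' + 1),
        c' ∈ bondsIn (j' + 1) (blockIter (((constrEnumB 𝔅 k).symm i).1 : ℕ) ⁻¹'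
          ({((constrEnumB 𝔅 k).symm i).2.1.src, ((constrEnumB 𝔅 k).symm i).2.1.tgt} : Set (Site P ((constrEnumB 𝔅 k).symm i).1))) →
          ∀ i' : Idx P, ‖loopMh (iterMh j' Q) c' i' - 1‖ < 1 :=
    eventually_all.2 fun i =>
      eventually_polydiscOn_one_constr ((Nat.lt_succ_iff.1 ((constrEnumB 𝔅 k).symm i).1.2).trans hk) _ (hg i)
  filter_upwards [hpolyAll, eventually_norm_rel_sub_one_lt_of_guardOn 𝔅 k hk W hg hW one_pos] with Q hpoly hrel
  rw [hfun]
  refine analyticAt_pi_iff.2 fun i => ?_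
  have hr := hrel i
  set s := (constrEnumB 𝔅 k).symm i with hs
  have hj : (s.1 : ℕ) ≤ P.m + P.K := (Nat.lt_succ_iff.1 s.1.2).trans hk
  have hit : AnalyticAt ℂ (fun Q : PBond P 0 → Matrix (Fin 2) (Fin 2) ℂ => iterMh (s.1 : ℕ) Q s.2.1) Q :=
    analyticAt_iterMh_apply_of_polydiscOn _ hj (preimage_blockIter_saturated hj _) (hpoly i) _ (self_mem_bondsIn_towerRegion hj _)
  have hin : AnalyticAt ℂ (fun Q : PBond P 0 → Matrix (Fin 2) (Fin 2) ℂ =>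
      star ((W s.1 s.2.1 : SU2) : Matrix (Fin 2) (Fin 2) ℂ) * iterMh s.1 Q s.2.1) Q :=
    analyticAt_const.mul hit
  have hlog : AnalyticAt ℂ logCoordC (star ((W s.1 s.2.1 : SU2) : Matrix (Fin 2) (Fin 2) ℂ) * iterMh s.1 Q s.2.1) :=
    analyticAt_logCoordC hr
  exact AnalyticAt.comp (f := fun Q : PBond P 0 → Matrix (Fin 2) (Fin 2) ℂ =>
    star ((W s.1 s.2.1 : SU2) : Matrix (Fin 2) (Fin 2) ℂ) * iterMh s.1 Q s.2.1) (x := Q) hlog hin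

/-- ★★ **THE DATUM COORDINATES ARE ℂ-DIFFERENTIABLE NEAR THE BASE DATUM** under the tower guards — the hypothesis `hκd` of `exists_localChart_of_criticalFamily_local`.
[cite: Balaban1985Variational, Prop. 9 (190) p.309] -/
theorem eventually_differentiableAt_datumCoord_of_guardOn {Q₀ : GaugeField P 0 SU2}
    (hg : ∀ i : Fin (constrCardB 𝔅 k), ∀ j', j' < (((constrEnumB 𝔅 k).symm i).1 : ℕ) → ∀ c' : PBond P (j' + 1),
      c' ∈ bondsIn (j' + 1) (blockIter (((constrEnumB 𝔅 k).symm i).1 : ℕ) ⁻¹'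
        ({((constrEnumB 𝔅 k).symm i).2.1.src, ((constrEnumB 𝔅 k).symm i).2.1.tgt} : Set (Site P ((constrEnumB 𝔅 k).symm i).1))) →
        Small expMeanLogSU (Averaging.iter (fun j => blockAvg (P := P) (j := j) expMeanLogSU) j' Q₀) c')
    (hW : AgreeOnB 𝔅 (avgFamily (fun j => blockAvg (P := P) (j := j) expMeanLogSU) Q₀) W) :
    ∀ᶠ Q in 𝓝 (coeField Q₀), DifferentiableAt ℂ κ Q := by
  filter_upwards [eventually_analyticAt_datumCoord_of_guardOn 𝔅 k hk W κ hκ hg hW] with Q hQ using hQ.differentiableAt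

/-- ★★ **THE DATUM COORDINATES ARE REAL ON `SU(2)` DATA NEAR THE BASE** under the tower guards (twin of `eventually_datumCoord_real`): for `SU(2)` configurations `Q′` with `↑Q′` near `↑Q₀`,
`Q′` is tower-guarded at every constrained bond (§1), its relative averages `W⋆·Ū(Q′)` are `SU(2)` matrices within `1∕3` of `1`, and there `logCoordC ((A⋆)⁻¹) = conj (logCoordC A)` with
`(A⋆)⁻¹ = A` — the hypothesis `hκreal`. [cite: Balaban1985Variational, p.307, (181) p.307, Prop. 9 (190) p.309; Balaban1985Averaging, (23) p.21] -/
theorem eventually_datumCoord_real_of_guardOn {Q₀ : GaugeField P 0 SU2}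
    (hg : ∀ i : Fin (constrCardB 𝔅 k), ∀ j', j' < (((constrEnumB 𝔅 k).symm i).1 : ℕ) → ∀ c' : PBond P (j' + 1),
      c' ∈ bondsIn (j' + 1) (blockIter (((constrEnumB 𝔅 k).symm i).1 : ℕ) ⁻¹'
        ({((constrEnumB 𝔅 k).symm i).2.1.src, ((constrEnumB 𝔅 k).symm i).2.1.tgt} : Set (Site P ((constrEnumB 𝔅 k).symm i).1))) →
        Small expMeanLogSU (Averaging.iter (fun j => blockAvg (P := P) (j := j) expMeanLogSU) j' Q₀) c')
    (hW : AgreeOnB 𝔅 (avgFamily (fun j => blockAvg (P := P) (j := j) expMeanLogSU) Q₀) W)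
    (cF : (Fin (constrCardB 𝔅 k) → EuclideanSpace ℂ (Fin 3)) → Fin (constrCardB 𝔅 k) → EuclideanSpace ℂ (Fin 3))
    (hcF : ∀ v i a, cF v i a = conj (v i a)) :
    ∀ᶠ Q in 𝓝 (coeField Q₀), ∀ Q' : GaugeField P 0 SU2, coeField Q' = Q → cF (κ Q) = κ Q := by
  filter_upwards [eventually_guardOn_constr 𝔅 k hk hg, eventually_norm_rel_sub_one_lt_of_guardOn 𝔅 k hk W hg hW (by norm_num : (0 : ℝ) < 1 / 3)]
    with Q hguard hrel Q' hQ'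
  have hg' := hguard Q' hQ'
  subst hQ'
  funext i; ext a
  rw [hcF, hκ]
  set s := (constrEnumB 𝔅 k).symm i with hs
  have hj : (s.1 : ℕ) ≤ P.m + P.K := (Nat.lt_succ_iff.1 s.1.2).trans hk
  have hA := star_coe_mul_iterMh_coeField_of_guardOn W hj s.2.1 (hg' i)
  have hr := (hrel i).le
  rw [hA] at hr ⊢
  have hθ := logCoordC_theta hr
  rw [star_inv_relMatrix] at hθ
  have ha := congrArg (fun v : EuclideanSpace ℂ (Fin 3) => v a) hθ
  simp only at ha
  exact ha.symm

/-- ★★ **THE DATUM COORDINATES INTERTWINE `θ` WITH COORDINATEWISE CONJUGATION NEAR THE BASE** under the tower guards (twin of `eventually_datumCoord_theta`): for `Q` near `↑Q₀` with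
invertible entries, `κ (θ ∘ Q) = conj ∘ κ Q` — `θ` passes the iterate AT EACH CONSTRAINED BOND on the tower `1∕3`-polydisc (`…LocalAnalytic.iterMh_theta_apply_of_polydiscOn`), `W⋆ · θ(M) = θ(W⋆ · M)`
for unitary `W`, and `logCoordC ∘ θ = conj ∘ logCoordC` within `1∕3` of `1`. [cite: Balaban1985Variational, p.307, (181) p.307, Prop. 9 (190) p.309; Balaban1985Averaging, (23) p.21] -/
theorem eventually_datumCoord_theta_of_guardOn {Q₀ : GaugeField P 0 SU2}
    (hg : ∀ i : Fin (constrCardB 𝔅 k), ∀ j', j' < (((constrEnumB 𝔅 k).symm i).1 : ℕ) → ∀ c' : PBond P (j' + 1),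
      c' ∈ bondsIn (j' + 1) (blockIter (((constrEnumB 𝔅 k).symm i).1 : ℕ) ⁻¹'
        ({((constrEnumB 𝔅 k).symm i).2.1.src, ((constrEnumB 𝔅 k).symm i).2.1.tgt} : Set (Site P ((constrEnumB 𝔅 k).symm i).1))) →
        Small expMeanLogSU (Averaging.iter (fun j => blockAvg (P := P) (j := j) expMeanLogSU) j' Q₀) c')
    (hW : AgreeOnB 𝔅 (avgFamily (fun j => blockAvg (P := P) (j := j) expMeanLogSU) Q₀) W)
    (cF : (Fin (constrCardB 𝔅 k) → EuclideanSpace ℂ (Fin 3)) → Fin (constrCardB 𝔅 k) → EuclideanSpace ℂ (Fin 3))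
    (hcF : ∀ v i a, cF v i a = conj (v i a)) :
    ∀ᶠ Q in 𝓝 (coeField Q₀), (∀ b, IsUnit (Q b).det) → κ (fun b => (star (Q b))⁻¹) = cF (κ Q) := by
  -- the tower `1∕3`-polydisc at `↑Q₀` for every constrained bond, and its persistence nearby
  have h3All : ∀ᶠ Q in 𝓝 (coeField Q₀), ∀ i : Fin (constrCardB 𝔅 k),
      ∀ j', j' < (((constrEnumB 𝔅 k).symm i).1 : ℕ) → ∀ c' : PBond P (j' + 1),
        c' ∈ bondsIn (j' + 1) (blockIter (((constrEnumB 𝔅 k).symm i).1 : ℕ) ⁻¹'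
          ({((constrEnumB 𝔅 k).symm i).2.1.src, ((constrEnumB 𝔅 k).symm i).2.1.tgt} : Set (Site P ((constrEnumB 𝔅 k).symm i).1))) →
          ∀ i' : Idx P, ‖loopMh (iterMh j' Q) c' i' - 1‖ < 1 / 3 := by
    refine eventually_all.2 fun i => ?_
    have hj : ((((constrEnumB 𝔅 k).symm i).1 : ℕ)) ≤ P.m + P.K := (Nat.lt_succ_iff.1 ((constrEnumB 𝔅 k).symm i).1.2).trans hk
    exact eventually_polydiscOn _ hj (preimage_blockIter_saturated hj _) (by norm_num : (1 : ℝ) / 3 ≤ 1)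
      fun j' hj' c' hc' i' => lt_third_of_lt_deltaSU (polydiscOn_constr_of_guardOn hj _ (hg i) (fun _ _ => rfl) j' hj' c' hc' i')
  filter_upwards [h3All, eventually_norm_rel_sub_one_lt_of_guardOn 𝔅 k hk W hg hW (by norm_num : (0 : ℝ) < 1 / 3)] with Q hpoly hrel hunit
  funext i; ext a
  rw [hcF, hκ, hκ]
  have hr := (hrel i).le
  set s := (constrEnumB 𝔅 k).symm i with hs
  have hj : (s.1 : ℕ) ≤ P.m + P.K := (Nat.lt_succ_iff.1 s.1.2).trans hk
  have hθ : iterMh (s.1 : ℕ) (fun b => (star (Q b))⁻¹) s.2.1 = (star (iterMh (s.1 : ℕ) Q s.2.1))⁻¹ :=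
    iterMh_theta_apply_of_polydiscOn hunit _ hj (preimage_blockIter_saturated hj _) (fun j' hj' c' hc' i' => (hpoly i j' hj' c' hc' i').le)
      _ (self_mem_bondsIn_towerRegion hj _)
  have hWinv : (((W s.1 s.2.1 : SU2) : Matrix (Fin 2) (Fin 2) ℂ))⁻¹ = star ((W s.1 s.2.1 : SU2) : Matrix (Fin 2) (Fin 2) ℂ) :=
    Matrix.inv_eq_left_inv (star_coe_mul_coe_SU _)
  have hprod : star ((W s.1 s.2.1 : SU2) : Matrix (Fin 2) (Fin 2) ℂ) * (star (iterMh (s.1 : ℕ) Q s.2.1))⁻¹ =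
      (star (star ((W s.1 s.2.1 : SU2) : Matrix (Fin 2) (Fin 2) ℂ) * iterMh (s.1 : ℕ) Q s.2.1))⁻¹ := by
    rw [B15AveragingHolomorphic.star_inv_mul_star_inv, star_star, hWinv]
  rw [hθ, hprod, logCoordC_theta hr]

end Coordinates

/-! ## §3  Injectivity on the fibre side under the tower guards -/

section Injective

variable {P : Params} (𝔅 : BDetSet P) (k : ℕ) (hk : k ≤ P.m + P.K) (W : MSField P SU2)
  (κ : (PBond P 0 → Matrix (Fin 2) (Fin 2) ℂ) → Fin (constrCardB 𝔅 k) → EuclideanSpace ℂ (Fin 3))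
  (hκ : ∀ Q i, κ Q i = logCoordC (star ((W ((constrEnumB 𝔅 k).symm i).1 ((constrEnumB 𝔅 k).symm i).2.1 : SU2) : Matrix (Fin 2) (Fin 2) ℂ) *
    iterMh ((constrEnumB 𝔅 k).symm i).1 Q ((constrEnumB 𝔅 k).symm i).2.1))
include hk hκ

/-- ★★ **EQUAL COORDINATES ⇒ EQUAL AVERAGES ON `𝔅`** under the tower guards (twin of `agreeOn_of_datumCoord_eq`): for a determining set of levels `≤ k`, two `SU(2)` fields guarded along the
towers of the constrained bonds, whose relative averages there lie within `1∕3` of `1` and whose datum coordinates coincide, have the same multi-scale averages on `𝔅`.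
[cite: Balaban1988Convergent, (2.10)–(2.11) p.256; Balaban1985Averaging, (21) p.21; Balaban1985Variational, Sect. C (47)–(48) p.285] -/
theorem agreeOn_of_datumCoord_eq_of_guardOn (h𝔅 : ∀ j, k < j → 𝔅 j = ∅) {U Q' : GaugeField P 0 SU2}
    (hgU : ∀ i : Fin (constrCardB 𝔅 k), ∀ j', j' < (((constrEnumB 𝔅 k).symm i).1 : ℕ) → ∀ c' : PBond P (j' + 1),
      c' ∈ bondsIn (j' + 1) (blockIter (((constrEnumB 𝔅 k).symm i).1 : ℕ) ⁻¹'
        ({((constrEnumB 𝔅 k).symm i).2.1.src, ((constrEnumB 𝔅 k).symm i).2.1.tgt} : Set (Site P ((constrEnumB 𝔅 k).symm i).1))) →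
        Small expMeanLogSU (Averaging.iter (fun j => blockAvg (P := P) (j := j) expMeanLogSU) j' U) c')
    (hgQ : ∀ i : Fin (constrCardB 𝔅 k), ∀ j', j' < (((constrEnumB 𝔅 k).symm i).1 : ℕ) → ∀ c' : PBond P (j' + 1),
      c' ∈ bondsIn (j' + 1) (blockIter (((constrEnumB 𝔅 k).symm i).1 : ℕ) ⁻¹'
        ({((constrEnumB 𝔅 k).symm i).2.1.src, ((constrEnumB 𝔅 k).symm i).2.1.tgt} : Set (Site P ((constrEnumB 𝔅 k).symm i).1))) →
        Small expMeanLogSU (Averaging.iter (fun j => blockAvg (P := P) (j := j) expMeanLogSU) j' Q') c')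
    (hrU : ∀ i : Fin (constrCardB 𝔅 k), ‖star ((W ((constrEnumB 𝔅 k).symm i).1 ((constrEnumB 𝔅 k).symm i).2.1 : SU2) : Matrix (Fin 2) (Fin 2) ℂ) *
      iterMh ((constrEnumB 𝔅 k).symm i).1 (coeField U) ((constrEnumB 𝔅 k).symm i).2.1 - 1‖ ≤ 1 / 3)
    (hrQ : ∀ i : Fin (constrCardB 𝔅 k), ‖star ((W ((constrEnumB 𝔅 k).symm i).1 ((constrEnumB 𝔅 k).symm i).2.1 : SU2) : Matrix (Fin 2) (Fin 2) ℂ) *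
      iterMh ((constrEnumB 𝔅 k).symm i).1 (coeField Q') ((constrEnumB 𝔅 k).symm i).2.1 - 1‖ ≤ 1 / 3)
    (heq : κ (coeField U) = κ (coeField Q')) :
    AgreeOnB 𝔅 (avgFamily (fun j => blockAvg (P := P) (j := j) expMeanLogSU) U) (avgFamily (fun j => blockAvg (P := P) (j := j) expMeanLogSU) Q') := by
  intro j c hc
  by_cases hjk : k < j
  · rw [h𝔅 j hjk] at hc
    simp at hc
  have hj : j ≤ k := Nat.le_of_not_lt hjk
  have hjK : j ≤ P.m + P.K := hj.trans hk
  let s₀ : ConstrSetB 𝔅 k := ⟨⟨j, Nat.lt_succ_of_le hj⟩, c, hc⟩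
  have hi := congrFun heq (constrEnumB 𝔅 k s₀)
  have hrU' := hrU (constrEnumB 𝔅 k s₀)
  have hrQ' := hrQ (constrEnumB 𝔅 k s₀)
  have hgU' := hgU (constrEnumB 𝔅 k s₀)
  have hgQ' := hgQ (constrEnumB 𝔅 k s₀)
  rw [hκ, hκ, Equiv.symm_apply_apply] at hi
  rw [Equiv.symm_apply_apply] at hrU' hrQ' hgU' hgQ'
  change logCoordC (star ((W j c : SU2) : Matrix (Fin 2) (Fin 2) ℂ) * iterMh j (coeField U) c) =
    logCoordC (star ((W j c : SU2) : Matrix (Fin 2) (Fin 2) ℂ) * iterMh j (coeField Q') c) at hi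
  change ‖star ((W j c : SU2) : Matrix (Fin 2) (Fin 2) ℂ) * iterMh j (coeField U) c - 1‖ ≤ 1 / 3 at hrU'
  change ‖star ((W j c : SU2) : Matrix (Fin 2) (Fin 2) ℂ) * iterMh j (coeField Q') c - 1‖ ≤ 1 / 3 at hrQ'
  change ∀ j', j' < j → ∀ c' : PBond P (j' + 1), c' ∈ bondsIn (j' + 1) (blockIter j ⁻¹' ({c.src, c.tgt} : Set (Site P j))) →
    Small expMeanLogSU (Averaging.iter (fun j => blockAvg (P := P) (j := j) expMeanLogSU) j' U) c' at hgU'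
  change ∀ j', j' < j → ∀ c' : PBond P (j' + 1), c' ∈ bondsIn (j' + 1) (blockIter j ⁻¹' ({c.src, c.tgt} : Set (Site P j))) →
    Small expMeanLogSU (Averaging.iter (fun j => blockAvg (P := P) (j := j) expMeanLogSU) j' Q') c' at hgQ'
  rw [star_coe_mul_iterMh_coeField_of_guardOn W hjK c hgU'] at hi hrU'
  rw [star_coe_mul_iterMh_coeField_of_guardOn W hjK c hgQ'] at hi hrQ'
  have hmat : star ((W j c : SU2) : Matrix (Fin 2) (Fin 2) ℂ) * ((avgFamily (fun j => blockAvg (P := P) (j := j) expMeanLogSU) U j c : SU2) : Matrix (Fin 2) (Fin 2) ℂ) =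
      star ((W j c : SU2) : Matrix (Fin 2) (Fin 2) ℂ) * ((avgFamily (fun j => blockAvg (P := P) (j := j) expMeanLogSU) Q' j c : SU2) : Matrix (Fin 2) (Fin 2) ℂ) := by
    rw [← expPointC_logCoordC hrU' (det_relMatrix _ _), ← expPointC_logCoordC hrQ' (det_relMatrix _ _), hi]
  have hcancel := congrArg (fun M => ((W j c : SU2) : Matrix (Fin 2) (Fin 2) ℂ) * M) hmat
  simp only [← mul_assoc, coe_mul_star_coe_SU, one_mul] at hcancel
  exact Subtype.ext hcancel

/-- ★ **THE FIBRE TRANSFER NEAR A PAIR OF BASE FIELDS** under the tower guards (twin of `eventually_agreeOn_of_datumCoord_eq`): near `(↑U₀, ↑Q₀)`, with `U₀`, `Q₀` guarded along the towers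
of the constrained bonds and both on the fibre of `W`, any two `SU(2)` fields with those matrix fields and EQUAL datum coordinates have equal averages on `𝔅` — the fibre clause of `htransfer`.
[cite: Balaban1988Convergent, (2.10)–(2.12) p.256; Balaban1985Variational, Sect. C (47)–(48) p.285, Prop. 9 p.309] -/
theorem eventually_agreeOn_of_datumCoord_eq_of_guardOn (h𝔅 : ∀ j, k < j → 𝔅 j = ∅) {U₀ Q₀ : GaugeField P 0 SU2}
    (hgU : ∀ i : Fin (constrCardB 𝔅 k), ∀ j', j' < (((constrEnumB 𝔅 k).symm i).1 : ℕ) → ∀ c' : PBond P (j' + 1),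
      c' ∈ bondsIn (j' + 1) (blockIter (((constrEnumB 𝔅 k).symm i).1 : ℕ) ⁻¹'
        ({((constrEnumB 𝔅 k).symm i).2.1.src, ((constrEnumB 𝔅 k).symm i).2.1.tgt} : Set (Site P ((constrEnumB 𝔅 k).symm i).1))) →
        Small expMeanLogSU (Averaging.iter (fun j => blockAvg (P := P) (j := j) expMeanLogSU) j' U₀) c')
    (hgQ : ∀ i : Fin (constrCardB 𝔅 k), ∀ j', j' < (((constrEnumB 𝔅 k).symm i).1 : ℕ) → ∀ c' : PBond P (j' + 1),
      c' ∈ bondsIn (j' + 1) (blockIter (((constrEnumB 𝔅 k).symm i).1 : ℕ) ⁻¹'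
        ({((constrEnumB 𝔅 k).symm i).2.1.src, ((constrEnumB 𝔅 k).symm i).2.1.tgt} : Set (Site P ((constrEnumB 𝔅 k).symm i).1))) →
        Small expMeanLogSU (Averaging.iter (fun j => blockAvg (P := P) (j := j) expMeanLogSU) j' Q₀) c')
    (hU : AgreeOnB 𝔅 (avgFamily (fun j => blockAvg (P := P) (j := j) expMeanLogSU) U₀) W)
    (hQ : AgreeOnB 𝔅 (avgFamily (fun j => blockAvg (P := P) (j := j) expMeanLogSU) Q₀) W) :
    ∀ᶠ w in 𝓝 (coeField U₀, coeField Q₀), ∀ U' Q' : GaugeField P 0 SU2, coeField U' = w.1 → coeField Q' = w.2 → κ w.1 = κ w.2 →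
      AgreeOnB 𝔅 (avgFamily (fun j => blockAvg (P := P) (j := j) expMeanLogSU) U') (avgFamily (fun j => blockAvg (P := P) (j := j) expMeanLogSU) Q') := by
  have h3 : (0 : ℝ) < 1 / 3 := by norm_num
  have hU' := (eventually_guardOn_constr 𝔅 k hk hgU).and (eventually_norm_rel_sub_one_lt_of_guardOn 𝔅 k hk W hgU hU h3)
  have hQ' := (eventually_guardOn_constr 𝔅 k hk hgQ).and (eventually_norm_rel_sub_one_lt_of_guardOn 𝔅 k hk W hgQ hQ h3)
  filter_upwards [hU'.prod_nhds hQ'] with w hw U' Q' hU'w hQ'w heq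
  obtain ⟨⟨hgU', hrU⟩, ⟨hgQ', hrQ⟩⟩ := hw
  refine agreeOn_of_datumCoord_eq_of_guardOn 𝔅 k hk W κ hκ h𝔅 (hgU' U' hU'w) (hgQ' Q' hQ'w) (fun i => ?_) (fun i => ?_) (by rw [hU'w, hQ'w]; exact heq)
  · rw [hU'w]; exact (hrU i).le
  · rw [hQ'w]; exact (hrQ i).le

end Injective

end Literature.MathematicalPhysics.QuantumFieldTheory.Balaban1983to89.B15Prop1DatumCoordinatesTowerB

end
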